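import Mathlib

/-!
# Finiteness propagation from univariate eliminants (the algebraic half of `certs/propagation/PROPAGATION.md`)

If every coordinate of every solution of a system `F = 0` is a root of a fixed non-zero univariate polynomial
(which is what specialising eliminant identities `h · p_j(x_j) = Σ a_ij F_i` at a parameter value with
`h(w₀) ≠ 0`, `lc(p_j)(w₀) ≠ 0` provides), then the solution set is finite.  Elementary; recorded so that a
per-cell finiteness certificate for the n-body systems of `certs/systems/` has a kernel-checked last step. [folklore]
-/

namespace Literature.Dynamics.NBody

open Polynomial

/-- A set of points of `Kⁿ` each of whose coordinates is a root of a fixed non-zero univariate polynomial is finite. [folklore] -/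
theorem finite_of_coordinate_eliminants {K : Type*} [Field K] {n : ℕ} (p : Fin n → K[X])
    (hp : ∀ j, p j ≠ 0) (S : Set (Fin n → K)) (hS : ∀ x ∈ S, ∀ j, (p j).IsRoot (x j)) : S.Finite := by
  classical
  have hfin : (Set.univ.pi fun j : Fin n => {a : K | a ∈ (p j).roots}).Finite :=
    Set.Finite.pi fun j => ((p j).roots.toFinset.finite_toSet).subset fun a ha => by
      simpa [Multiset.mem_toFinset] using ha
  refine hfin.subset ?_
  intro x hx
  simp only [Set.mem_pi, Set.mem_univ, true_implies, Set.mem_setOf_eq]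
  intro j
  exact (Polynomial.mem_roots (hp j)).2 (hS x hx j)

/-- Propagation on an open cell, specialised form: if for each coordinate `j` the identity
`h₀ · p_j(x_j) = Σ_i a_ij(x) F_i(x)` holds at the parameter value (so that `F(x) = 0` forces `h₀ · p_j(x_j) = 0`),
with `h₀ ≠ 0` and `p_j ≠ 0`, then the fibre `{x | F x = 0}` is finite. [folklore] -/
theorem finite_fibre_of_eliminant_identities {K : Type*} [Field K] {n r : ℕ}
    (F : Fin r → (Fin n → K) → K) (p : Fin n → K[X]) (h₀ : K) (hh : h₀ ≠ 0) (hp : ∀ j, p j ≠ 0)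
    (hid : ∀ j (x : Fin n → K), (∀ i, F i x = 0) → h₀ * (p j).eval (x j) = 0) :
    {x : Fin n → K | ∀ i, F i x = 0}.Finite := by
  refine finite_of_coordinate_eliminants p hp _ ?_
  intro x hx j
  have := hid j x hx
  rcases mul_eq_zero.1 this with h | h
  · exact absurd h hh
  · exact h

/-- The cofactor form actually produced by an elimination: explicit `a_ij` with
`h₀ · p_j(x_j) = Σ_i a_ij(x) · F_i(x)` for all `x`. [folklore] -/
theorem finite_fibre_of_cofactor_identities {K : Type*} [Field K] {n r : ℕ}
    (F : Fin r → (Fin n → K) → K) (p : Fin n → K[X]) (a : Fin n → Fin r → (Fin n → K) → K)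
    (h₀ : K) (hh : h₀ ≠ 0) (hp : ∀ j, p j ≠ 0)
    (hid : ∀ j (x : Fin n → K), h₀ * (p j).eval (x j) = ∑ i, a j i x * F i x) :
    {x : Fin n → K | ∀ i, F i x = 0}.Finite := by
  refine finite_fibre_of_eliminant_identities F p h₀ hh hp ?_
  intro j x hx
  rw [hid j x]
  exact Finset.sum_eq_zero fun i _ => by rw [hx i, mul_zero]

end Literature.Dynamics.NBody
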